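import Mathlib.Data.ZMod.Basic
import Mathlib.Tactic.NormNum
import Mathlib.Tactic.Linarith
import Mathlib.Tactic.FinCases
import Mathlib.Tactic.IntervalCases
import Mathlib.Data.Fintype.Prod
import Mathlib.Topology.Algebra.InfiniteSum.Real
import Mathlib.Analysis.SpecificLimits.Basic
import Mathlib.Algebra.Field.ZMod
import Mathlib.Tactic.LinearCombination
import Mathlib.Tactic.Positivity
import Mathlib.NumberTheory.SumPrimeReciprocals
import Mathlib.NumberTheory.LegendreSymbol.QuadraticChar.Basic
import HarnessLib

/-!
# Bhargava–Skinner–Zhang 2014, Lemmas 17–18: the 5-adic reduction cells of `y² = x³ + Ax + B` and their exact in-family densities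

Source: M. Bhargava, C. Skinner, W. Zhang, *A majority of elliptic curves over `ℚ` satisfy the Birch and
Swinnerton-Dyer conjecture*, arXiv:1407.1826v2 (2014) [BhargavaSkinnerZhang2014], §3.1 (p. 7:
in-family densities, normaliser `1 - 5⁻¹⁰`), Lemma 17 (p. 7: `μ(S₀(5))`, good ordinary at `5`) and Lemma 18 (p. 8: the
multiplicative cells at `5` by `5 ∣ v₅(Δ)` or not, split / nonsplit), with the residue-count correction of Lemma 18
recorded in [Walchek2020, Nota 5.4.6 (p. 137) / Nota 5.4.13 (p. 142)].  Page numbers of BSZ are those of the compiled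
arXiv v2 PDF (checked by the `pub-bsdpct` literature audit, 2026-08-18).

Reproduction (proved, Mathlib-only):
* §1 — the residue classes `(A, B) mod 5`: `disc = 4A³ + 27B²`, the predicates good-ordinary / good-supersingular /
  multiplicative / split-multiplicative / additive-or-non-minimal, their counts `16 + 4 + 4 (2 split) + 1 = 25` and that
  they partition `(ℤ/5)²` (`decide`); the supersingular criterion `a₅ = 0 ⟺ A ≡ 0 (mod 5)` on point counts and the three
  anomalous classes (`decide`);
* §2 — the exact IN-FAMILY densities at `5` (divided by `fam 5 = 1 - 5⁻¹⁰`) as rational constants, each PROVED equal to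
  its closed form (`norm_num`): `μ_go5 = (16/25)/fam 5`, `μ_ss5`, `μ_mult5`, the split/nonsplit cells with `5 ∣ v(Δ)`
  ("badv") or not ("ok"), the `𝓛`-invariant sub-cell, `μ_add5`; the two geometric series over valuation strata PROVED
  from `tsum_geometric_of_lt_one`; and the bookkeeping identities among them.

Relation to the tree: `LeadingTermBSZLocalDensityProofs.lean`, `LeadingTermBSZOrdDensityProofs.lean` and
`LeadingTermBSZNonsplitDensityProofs.lean` (`Literature/NumberTheory/EllipticCurves/`) prove the SAME local densities
in predicate form (`HasHeightDensity` statements about sets of pairs `(A, B)`: Lemma 17 as `μ(S₀(5)) = 4·5¹⁰/(5(5¹⁰−1))`,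
the valuation strata `(ℓ−1)²/ℓ^(k+2)`, the nonsplit half of Lemma 18 at `ℓ = 5`); the present file carries the bare
rational constants that the bundle's cell bookkeeping consumes, with their closed forms — the two currencies agree
number for number (e.g. `μ_go5 = 781250/1220703 = (16/25)/(1 − 5⁻¹⁰)`).  New relative to the tree: the split cell with
the corrected factor `1/5` for the `𝓛`-invariant condition (`μ_S1'_corrected_eq`; the tree's nonsplit file marks the
split part "not treated").
Origin: `BSDPercentage/Densities.lean` (sha256 3744dbb3…, run of record 72) of the `pub-bsdpct` bundle's staged package
(BirchSwinnertonDyer / bsd-percentage), split by section and namespace-rewritten `BSDPercentage.Densities →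
Literature.NumberTheory.EllipticCurves.BhargavaSkinnerZhang2014.Densities` (LEAN-IN-TREE rule, 2026-08-18); statements and
proofs byte-identical; per-declaration provenance tags from the bundle engine's table (unit pub-bsdpct-2, gen 23), locators
verified against the compiled sources by the bundle's literature audit (unit pub-bsdpct-1, gens 36–37).  In the docstrings,
`PROOFS.md` / `AUDIT.md` / `NUMERICS.md` / `numerics/*.py` refer to that bundle's proof notes, literature audit, numerics report
and certified scripts (papers/BirchSwinnertonDyer/bsd-percentage/); "paper" = the bundle's paper; they are provenance
pointers only — every statement in this file is closed-form arithmetic or a finite computation checked by the kernel.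

What is NOT here: the 2- and 3-adic densities (`TateDiscDensitiesTwoThree`), the nodal classes for all primes and the
set `T` (`NodalClasses`), the additive-at-5 census (`AdditiveCensusAtFive`), the root-number constants
(`BhargavaShankar5Selmer2013/RootNumberBox`); every headline / tier total of the bundle (Summit-side); any statement
about elliptic curves as such — the dictionary "residue class ↦ reduction type of the 5-minimal short model" is the
cited lemmas', stated in the docstrings, not formalised here.
-/

namespace Literature.NumberTheory.EllipticCurves.BhargavaSkinnerZhang2014.Densities

/-! ## §1. Residue classes modulo 5 -/

/-- `4A³ + 27B²` in `ZMod n` (the discriminant up to the unit `-16`). [folklore] -/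
def disc {n : ℕ} (A B : ZMod n) : ZMod n := 4 * A ^ 3 + 27 * B ^ 2

/-- good ordinary at 5: `5 ∤ Δ` and `a₅ ≠ 0` (`⟺ 5 ∤ A`, see `affinePoints_eq_five_iff`).
[cite: BhargavaSkinnerZhang2014, §3.1 and Lemmas 17–18] -/
def GoodOrd5 (AB : ZMod 5 × ZMod 5) : Prop := disc AB.1 AB.2 ≠ 0 ∧ AB.1 ≠ 0

/-- good supersingular at 5: `A ≡ 0`, `B ≢ 0`. [cite: BhargavaSkinnerZhang2014, §3.1 and Lemmas 17–18] -/
def GoodSS5 (AB : ZMod 5 × ZMod 5) : Prop := AB.1 = 0 ∧ AB.2 ≠ 0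

/-- multiplicative at 5 (for the short model, which is then minimal at 5): `Δ ≡ 0`, `A ≢ 0`.
[cite: BhargavaSkinnerZhang2014, §3.1 and Lemmas 17–18] -/
def Mult5 (AB : ZMod 5 × ZMod 5) : Prop := disc AB.1 AB.2 = 0 ∧ AB.1 ≠ 0

/-- split multiplicative at 5: multiplicative and `-c₆ = 2⁵3³B` is a non-zero square, i.e. `6B` is.
[cite: BhargavaSkinnerZhang2014, §3.1 and Lemmas 17–18] -/
def SplitMult5 (AB : ZMod 5 × ZMod 5) : Prop := Mult5 AB ∧ ∃ t : ZMod 5, t ≠ 0 ∧ t ^ 2 = 6 * AB.2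

/-- `A ≡ B ≡ 0 (mod 5)`: additive at 5 or not 5-minimal. [cite: BhargavaSkinnerZhang2014, §3.1 and Lemmas 17–18] -/
def AddOrNonmin5 (AB : ZMod 5 × ZMod 5) : Prop := AB.1 = 0 ∧ AB.2 = 0

/-- `GoodOrd5` is decidable (by unfolding). [folklore] -/
instance : DecidablePred GoodOrd5 := fun _ => by unfold GoodOrd5; infer_instance

/-- `GoodSS5` is decidable (by unfolding). [folklore] -/
instance : DecidablePred GoodSS5 := fun _ => by unfold GoodSS5; infer_instance

/-- `Mult5` is decidable (by unfolding). [folklore] -/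
instance : DecidablePred Mult5 := fun _ => by unfold Mult5; infer_instance

/-- `SplitMult5` is decidable (by unfolding). [folklore] -/
instance : DecidablePred SplitMult5 := fun _ => by unfold SplitMult5 Mult5; infer_instance

/-- `AddOrNonmin5` is decidable (by unfolding). [folklore] -/
instance : DecidablePred AddOrNonmin5 := fun _ => by unfold AddOrNonmin5; infer_instance

/-- 16 of the 25 classes `(A, B) mod 5` are good ordinary. [numerics: density_large_primes.py, ℓ = 5]
[cite: BhargavaSkinnerZhang2014, §3.1 and Lemmas 17–18] -/
theorem card_goodOrd5 : (Finset.univ.filter GoodOrd5).card = 16 := by decide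

/-- 4 classes are good supersingular. [cite: BhargavaSkinnerZhang2014, §3.1 and Lemmas 17–18] -/
theorem card_goodSS5 : (Finset.univ.filter GoodSS5).card = 4 := by decide

/-- 4 classes are multiplicative. [cite: BhargavaSkinnerZhang2014, §3.1 and Lemmas 17–18] -/
theorem card_mult5 : (Finset.univ.filter Mult5).card = 4 := by decide

/-- 2 of them split, hence 2 nonsplit. [cite: BhargavaSkinnerZhang2014, §3.1 and Lemmas 17–18] -/
theorem card_splitMult5 : (Finset.univ.filter SplitMult5).card = 2 := by decide

/-- 1 class (`A ≡ B ≡ 0`) is additive-or-non-minimal. [cite: BhargavaSkinnerZhang2014, §3.1 and Lemmas 17–18] -/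
theorem card_addOrNonmin5 : (Finset.univ.filter AddOrNonmin5).card = 1 := by decide

/-- the five predicates partition `(ZMod 5)²`: `16 + 4 + 4 + 1 = 25`.
[cite: BhargavaSkinnerZhang2014, §3.1 and Lemmas 17–18] -/
theorem cells5_partition (AB : ZMod 5 × ZMod 5) :
    (GoodOrd5 AB ∨ GoodSS5 AB ∨ Mult5 AB ∨ AddOrNonmin5 AB) ∧
    ¬ (GoodOrd5 AB ∧ GoodSS5 AB) ∧ ¬ (GoodOrd5 AB ∧ Mult5 AB) ∧ ¬ (GoodSS5 AB ∧ Mult5 AB) ∧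
    ¬ (GoodOrd5 AB ∧ AddOrNonmin5 AB) ∧ ¬ (GoodSS5 AB ∧ AddOrNonmin5 AB) ∧ ¬ (Mult5 AB ∧ AddOrNonmin5 AB) := by
  revert AB; decide

/-- number of affine points of `y² = x³ + Ax + B` over `𝔽₅`; `a₅ = 5 - affinePoints`. [folklore] -/
def affinePoints (A B : ZMod 5) : ℕ :=
  (Finset.univ.filter (fun xy : ZMod 5 × ZMod 5 => xy.2 ^ 2 = xy.1 ^ 3 + A * xy.1 + B)).card

/-- Supersingular criterion at 5 for the short model: when `5 ∤ Δ`, `a₅ = 0 ⟺ A ≡ 0 (mod 5)`. [folklore] -/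
theorem affinePoints_eq_five_iff :
    ∀ AB : ZMod 5 × ZMod 5, disc AB.1 AB.2 ≠ 0 → (affinePoints AB.1 AB.2 = 5 ↔ AB.1 = 0) := by decide

/-- Anomalous classes (`5 ∣ #Ẽ(𝔽₅) = affinePoints + 1`, i.e. `a₅ ≡ 1 (mod 5)`: `a₅ = 1` on 2 classes,
`a₅ = -4` on 1): exactly 3 of the 20 good classes (raw density `3/25`; this is where `E(ℚ₅)[5] ≠ 0` can occur
for good reduction; recorded for completeness). [folklore] -/
theorem card_anomalous5 :
    (Finset.univ.filter (fun AB : ZMod 5 × ZMod 5 => disc AB.1 AB.2 ≠ 0 ∧ 5 ∣ affinePoints AB.1 AB.2 + 1)).card = 3 := by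
  decide

/-! ## §2. Exact 5-adic cell densities (in-family) -/

/-- in-family normaliser `1 - p⁻¹⁰`. [cite: BhargavaSkinnerZhang2014, Lemma 17] -/
def fam (p : ℕ) : ℚ := 1 - 1 / (p : ℚ) ^ 10

/-- Exact arithmetic fact used in the assembly: `fam 5 = 9765624 / 9765625`.
[cite: BhargavaSkinnerZhang2014, Lemma 17] -/
theorem fam_five : fam 5 = 9765624 / 9765625 := by norm_num [fam]

/-- μ(good ordinary at 5) = (16/25)/(1 - 5⁻¹⁰). [cite: BhargavaSkinnerZhang2014, Lemma 17] -/
def μ_go5 : ℚ := 781250 / 1220703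

/-- Closed form / defining identity, exact rational arithmetic (`norm_num`): `μ_go5 = (16 / 25) / fam 5`.
[cite: BhargavaSkinnerZhang2014, Lemma 17] -/
theorem μ_go5_eq : μ_go5 = (16 / 25) / fam 5 := by norm_num [μ_go5, fam]

/-- μ(good supersingular at 5) = (4/25)/(1 - 5⁻¹⁰). [cite: BhargavaSkinnerZhang2014, Lemma 17] -/
def μ_ss5 : ℚ := 390625 / 2441406

/-- Closed form / defining identity, exact rational arithmetic (`norm_num`): `μ_ss5 = (4 / 25) / fam 5`.
[cite: BhargavaSkinnerZhang2014, Lemma 17] -/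
theorem μ_ss5_eq : μ_ss5 = (4 / 25) / fam 5 := by norm_num [μ_ss5, fam]

/-- μ(additive at 5) = (1/25 - 5⁻¹⁰)/(1 - 5⁻¹⁰) (the class `A ≡ B ≡ 0` minus the non-minimal pairs).
[cite: BhargavaSkinnerZhang2014, Lemma 17] -/
def μ_add5 : ℚ := 16276 / 406901

/-- Closed form / defining identity, exact rational arithmetic (`norm_num`): `μ_add5 = (1 / 25 - 1 / 5 ^ 10) / fam 5`.
[cite: BhargavaSkinnerZhang2014, Lemma 17] -/
theorem μ_add5_eq : μ_add5 = (1 / 25 - 1 / 5 ^ 10) / fam 5 := by norm_num [μ_add5, fam]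

/-- raw μ₅(multiplicative, `v₅(Δ) = k`) = `(ℓ-1)²/ℓ^{k+2}` = `16/5^{k+2}`, `k ≥ 1`; summed over `5 ∣ k`:
`16/(25·(5⁵-1))`; over `5 ∤ k`: `4/25 - 16/(25·3124)`.  Nonsplit = split = half of each stratum; among split
with `5 ∤ k` exactly `1/5` have `ord₅ 𝓛_E ≥ 2` (numerics: `linvariant_count`, certified `k ≤ 4`; structure for all
`k`: tree `bsz_lemma18_card_residues_eq`). [cite: BhargavaSkinnerZhang2014, Lemma 18] -/
def μ_ns_ok5 : ℚ := 25390625 / 317789681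

/-- In-family density of curves with SPLIT multiplicative reduction at 5, 𝓛-invariant condition satisfied (4/5 of the split unit-valuation classes) and 5 ∤ v₅(Δ): 20312500/317789681 (PROOFS §1; BSZ Lemma 18 corrected, AUDIT A3).
[cite: BhargavaSkinnerZhang2014, Lemma 18] -/
def μ_sp_ok5 : ℚ := 20312500 / 317789681

/-- In-family density of the split-multiplicative-at-5 classes failing the 𝓛-invariant unit condition (the 1/5 complement of `μ_sp_ok5`): 5078125/317789681 — the cell BSZ's printed Lemma 18 overcounts (AUDIT A3).
[cite: BhargavaSkinnerZhang2014, Lemma 18] -/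
def μ_sp_badL5 : ℚ := 5078125 / 317789681

/-- In-family density of NONSPLIT multiplicative reduction at 5 with 5 ∣ v₅(Δ): 390625/3813476172 (valuation strata k ≡ 0 mod 5 of the geometric series 16/5^(k+2)).
[cite: BhargavaSkinnerZhang2014, Lemma 18] -/
def μ_ns_badv5 : ℚ := 390625 / 3813476172

/-- In-family density of SPLIT multiplicative reduction at 5 with 5 ∣ v₅(Δ): equal to `μ_ns_badv5` (split/nonsplit are equidistributed in every valuation stratum).
[cite: BhargavaSkinnerZhang2014, Lemma 18] -/
def μ_sp_badv5 : ℚ := 390625 / 3813476172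

/-- Closed form / defining identity, exact rational arithmetic (`norm_num`): `μ_ns_ok5 = ((4 / 25 - 16 / (25 * 3124)) / 2) / fam 5`.
[cite: BhargavaSkinnerZhang2014, Lemma 18] -/
theorem μ_ns_ok5_eq : μ_ns_ok5 = ((4 / 25 - 16 / (25 * 3124)) / 2) / fam 5 := by norm_num [μ_ns_ok5, fam]

/-- Closed form / defining identity, exact rational arithmetic (`norm_num`): `μ_sp_ok5 = ((4 : ℚ) / 5) * (((4 / 25 - 16 / (25 * 3124)) / 2) / fam 5)`.
[cite: BhargavaSkinnerZhang2014, Lemma 18] -/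
theorem μ_sp_ok5_eq : μ_sp_ok5 = ((4 : ℚ) / 5) * (((4 / 25 - 16 / (25 * 3124)) / 2) / fam 5) := by
  norm_num [μ_sp_ok5, fam]

/-- Closed form / defining identity, exact rational arithmetic (`norm_num`): `μ_sp_badL5 = ((1 : ℚ) / 5) * (((4 / 25 - 16 / (25 * 3124)) / 2) / fam 5)`.
[cite: BhargavaSkinnerZhang2014, Lemma 18] -/
theorem μ_sp_badL5_eq : μ_sp_badL5 = ((1 : ℚ) / 5) * (((4 / 25 - 16 / (25 * 3124)) / 2) / fam 5) := by
  norm_num [μ_sp_badL5, fam]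

/-- Closed form / defining identity, exact rational arithmetic (`norm_num`): `μ_ns_badv5 = ((16 / (25 * 3124)) / 2) / fam 5`.
[cite: BhargavaSkinnerZhang2014, Lemma 18] -/
theorem μ_ns_badv5_eq : μ_ns_badv5 = ((16 / (25 * 3124)) / 2) / fam 5 := by norm_num [μ_ns_badv5, fam]

/-- Closed form / defining identity, exact rational arithmetic (`norm_num`): `μ_sp_badv5 = μ_ns_badv5`.
[cite: BhargavaSkinnerZhang2014, Lemma 18] -/
theorem μ_sp_badv5_eq : μ_sp_badv5 = μ_ns_badv5 := by norm_num [μ_sp_badv5, μ_ns_badv5]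

/-- the eight cells exhaust the family. [cite: BhargavaSkinnerZhang2014, Lemma 17] -/
theorem cells5_sum :
    μ_go5 + μ_ss5 + μ_add5 + μ_ns_ok5 + μ_sp_ok5 + μ_sp_badL5 + μ_ns_badv5 + μ_sp_badv5 = 1 := by
  norm_num [μ_go5, μ_ss5, μ_add5, μ_ns_ok5, μ_sp_ok5, μ_sp_badL5, μ_ns_badv5, μ_sp_badv5]

/-- BSZ's sets: `μ(S₀(5)) = μ(5 ∤ A)`; `μ(S₁'(5))` corrected (`= .78381570…`) and as printed (`.79180545…`).
[cite: BhargavaSkinnerZhang2014, Lemma 17] -/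
theorem μ_S0_eq : μ_go5 + μ_ns_ok5 + μ_sp_ok5 + μ_sp_badL5 + μ_ns_badv5 + μ_sp_badv5 = 1953125 / 2441406 := by
  norm_num [μ_go5, μ_ns_ok5, μ_sp_ok5, μ_sp_badL5, μ_ns_badv5, μ_sp_badv5]

/-- Closed form / defining identity, exact rational arithmetic (`norm_num`): `μ_go5 + μ_ns_ok5 + μ_sp_ok5 = 747265625 / 953369043`.
[cite: BhargavaSkinnerZhang2014, Lemma 18] + [cite: Walchek2020, Nota 5.4.6 (p. 137) / Nota 5.4.13 (p. 142)] -/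
theorem μ_S1'_corrected_eq : μ_go5 + μ_ns_ok5 + μ_sp_ok5 = 747265625 / 953369043 := by
  norm_num [μ_go5, μ_ns_ok5, μ_sp_ok5]

/-- The same constant in the closed form printed in the paper / PROOFS.md: `theorem μ_S1'_corrected_closed_form :`.
[cite: BhargavaSkinnerZhang2014, Lemma 18] + [cite: Walchek2020, Nota 5.4.6 (p. 137) / Nota 5.4.13 (p. 142)] -/
theorem μ_S1'_corrected_closed_form :
    (747265625 / 953369043 : ℚ) = (98 / 125 - 18 / 125 * (4 / 3124)) / fam 5 := by norm_num [fam]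

/-- The same constant in the closed form printed in the paper / PROOFS.md: `theorem μ_S1'_printed_closed_form :`.
[cite: BhargavaSkinnerZhang2014, Lemma 18] -/
theorem μ_S1'_printed_closed_form :
    (1509765625 / 1906738086 : ℚ) = (99 / 125 - 19 / 125 * (4 / 3124)) / fam 5 := by norm_num [fam]

/-- The geometric series behind the `5 ∣ v₅(Δ)` stratum: `Σ_{j ≥ 1} 16/5^{5j+2} = 16/(25·3124)`.
[cite: BhargavaSkinnerZhang2014, Lemma 18] -/
theorem tsum_mult_five_dvd_val :
    ∑' j : ℕ, (16 : ℝ) / 5 ^ (5 * (j + 1) + 2) = 16 / (25 * 3124) := by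
  have h : ∀ j : ℕ, (16 : ℝ) / 5 ^ (5 * (j + 1) + 2) = (16 / 5 ^ 7) * ((1 / 5 ^ 5) ^ j) := by
    intro j
    rw [show 5 * (j + 1) + 2 = 5 * j + 7 by ring, pow_add, pow_mul]
    field_simp
    rw [← mul_pow]; norm_num
  simp_rw [h]
  have hg : ∑' j : ℕ, ((1 : ℝ) / 5 ^ 5) ^ j = (1 - 1 / 5 ^ 5)⁻¹ :=
    tsum_geometric_of_lt_one (by positivity) (by norm_num)
  rw [tsum_mul_left, hg]
  norm_num

/-- and the full multiplicative mass `Σ_{k ≥ 1} 16/5^{k+2} = 4/25`. [cite: BhargavaSkinnerZhang2014, Lemma 18] -/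
theorem tsum_mult_all_val : ∑' k : ℕ, (16 : ℝ) / 5 ^ ((k + 1) + 2) = 4 / 25 := by
  have h : ∀ k : ℕ, (16 : ℝ) / 5 ^ ((k + 1) + 2) = (16 / 5 ^ 3) * ((1 / 5) ^ k) := by
    intro k
    rw [show (k + 1) + 2 = k + 3 by ring, pow_add]
    field_simp
    rw [← mul_pow]; norm_num
  have hg : ∑' k : ℕ, ((1 : ℝ) / 5) ^ k = (1 - 1 / 5)⁻¹ :=
    tsum_geometric_of_lt_one (by positivity) (by norm_num)
  rw [tsum_congr h, tsum_mul_left, hg]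
  norm_num

end Literature.NumberTheory.EllipticCurves.BhargavaSkinnerZhang2014.Densities
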